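import Summits.CriticalPhenomena.PercolationContinuityZ3.Theorems.PercNearOneGluingNoHeavyLowerTailCILRelayNeighbours
import HarnessLib

/-!
# `NoHeavyLowerTail` (stmt-CriticalPhenomena-4575) — CIL for an observer with at most two relay neighbours

Support file (prover `prim-gen-induct`; `--supports stmt-CriticalPhenomena-4575`).  No definitions, no named facts, no sorries.

`cil_twoRelayNeighbours`: if the observer `o ∉ A` has positive-weight edges only to (at most) two vertices and these are relays,
then for every level `j` some relay `a ∈ A` satisfies `μ{1 ≤ N ≤ j} ≤ μ{|π(a)| ≤ j}` — the registered stub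
`stub_cumulativeIsolation` on this class, for every `|A|` and an ARBITRARY weighted graph away from `o`.  It is the unconditional
`d ≤ 2` case of `Theorems.cil_relayNeighbours_of_portComparison` (file `…CILRelayNeighbours`): the port comparison (⋆) holds
for the port whose `H`-cluster (`H` = no edge at `o`) is more often light, because the only other port has no later port and on
`{p₁ ~' p₀}` the two `H`-clusters coincide.  Three or more relay neighbours need (⋆), the typed residual recorded there.
-/

noncomputable section

namespace Summit.CriticalPhenomena.PercolationContinuityZ3.Theorems

open MeasureTheory Set Literature.Probability.LatticeModels Literature.Probability.Percolation
open scoped Classical BigOperators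

variable {n : ℕ}

open CutObserver in
/-- Two relay ports, auxiliary form: if `o ∉ A` has positive-weight edges only to the relays `p₀ ≠ p₁` and the `H`-cluster of
`p₁` is light no more often than that of `p₀` (`H` = no edge at `o`), then `μ{1 ≤ N ≤ j} ≤ μ{|π(p₀)| ≤ j}`.  The port comparison
(⋆) of `cil_relayNeighbours_of_portComparison` is automatic here: for the only other port `p₁` there is no later port, and on
`{p₁ ~' p₀}` the two `H`-clusters coincide. [folklore] -/
theorem cil_twoRelayNeighbours_aux (w : Sym2 (Fin n) → unitInterval) (A : Finset (Fin n)) (o : Fin n) (j : ℕ)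
    (p₀ p₁ : Fin n) (hne : p₀ ≠ p₁) (h0 : p₀ ∈ A) (h1 : p₁ ∈ A) (hoA : o ∉ A)
    (hobs : ∀ v, w s(o, v) ≠ 0 → v = p₀ ∨ v = p₁)
    (hs : (prodBernoulli w).real {ω : BondConfig (Fin n) |
        (A.filter fun x => (openGraph (ω ∩ {e | o ∉ e})).Reachable p₁ x).card ≤ j} ≤
      (prodBernoulli w).real {ω : BondConfig (Fin n) |
        (A.filter fun x => (openGraph (ω ∩ {e | o ∉ e})).Reachable p₀ x).card ≤ j}) :
    (prodBernoulli w).real {ω : BondConfig (Fin n) |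
        1 ≤ (A.filter fun x => ω ∈ openConn o x).card ∧ (A.filter fun x => ω ∈ openConn o x).card ≤ j} ≤
      (prodBernoulli w).real {ω : BondConfig (Fin n) | (A.filter fun x => ω ∈ openConn p₀ x).card ≤ j} := by
  haveI : IsProbabilityMeasure (prodBernoulli w) := inferInstance
  set p : Fin 2 → Fin n := fun l => if l = 0 then p₀ else p₁ with hp
  have hp0 : p 0 = p₀ := by simp [hp]
  have hp1 : p 1 = p₁ := by simp [hp]
  have hpinj : Function.Injective p := by
    intro a b hab
    fin_cases a <;> fin_cases b
    · rfl
    · exact absurd (hp0.symm.trans (hab.trans hp1)) hne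
    · exact absurd (hp1.symm.trans (hab.trans hp0)) hne.symm
    · rfl
  have hpA : ∀ l, p l ∈ A := by
    intro l; fin_cases l
    · simpa [hp] using h0
    · simpa [hp] using h1
  have hobs' : ∀ v, w s(o, v) ≠ 0 → ∃ l, v = p l := by
    intro v hv
    rcases hobs v hv with rfl | rfl
    · exact ⟨0, hp0.symm⟩
    · exact ⟨1, hp1.symm⟩
  have key := cil_relayNeighbours_of_portComparison w A o j p hpinj hpA hoA hobs' 0 ?_
  · simpa [hp0] using key
  intro l hl
  have hl1 : l = 1 := by
    fin_cases l
    · exact absurd rfl hl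
    · rfl
  subst hl1
  rw [hp0, hp1]
  -- no later port: the second event is everything
  have huniv : {ω : BondConfig (Fin n) | ∀ m : Fin 2, 1 < m →
      (openGraph (ω ∩ {e | o ∉ e})).Reachable (p m) p₀ → s(o, p m) ∉ ω} = univ := by
    refine Set.eq_univ_of_forall fun ω m hm => ?_
    exfalso
    fin_cases m <;> simp at hm
  rw [huniv, inter_univ]
  -- on {p₁ ~' p₀} the two clusters coincide
  set Rset := {ω : BondConfig (Fin n) | (openGraph (ω ∩ {e | o ∉ e})).Reachable p₁ p₀} with hRset
  set S0 := {ω : BondConfig (Fin n) |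
    (A.filter fun x => (openGraph (ω ∩ {e | o ∉ e})).Reachable p₀ x).card ≤ j} with hS0
  set S1 := {ω : BondConfig (Fin n) |
    (A.filter fun x => (openGraph (ω ∩ {e | o ∉ e})).Reachable p₁ x).card ≤ j} with hS1
  have heq : S1 ∩ Rset = S0 ∩ Rset := by
    ext ω
    simp only [hS1, hS0, hRset, mem_inter_iff, mem_setOf_eq]
    constructor
    · rintro ⟨hc, hr⟩
      refine ⟨?_, hr⟩
      have : (A.filter fun x => (openGraph (ω ∩ {e | o ∉ e})).Reachable p₀ x) =
          (A.filter fun x => (openGraph (ω ∩ {e | o ∉ e})).Reachable p₁ x) :=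
        Finset.filter_congr fun x _ => ⟨fun h => hr.trans h, fun h => hr.symm.trans h⟩
      rw [this]; exact hc
    · rintro ⟨hc, hr⟩
      refine ⟨?_, hr⟩
      have : (A.filter fun x => (openGraph (ω ∩ {e | o ∉ e})).Reachable p₁ x) =
          (A.filter fun x => (openGraph (ω ∩ {e | o ∉ e})).Reachable p₀ x) :=
        Finset.filter_congr fun x _ => ⟨fun h => hr.symm.trans h, fun h => hr.trans h⟩
      rw [this]; exact hc
  have hd1 : {ω : BondConfig (Fin n) | ¬ (openGraph (ω ∩ {e | o ∉ e})).Reachable p₁ p₀} ∩ S1 = S1 \ Rset := by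
    ext ω; simp only [hRset, mem_inter_iff, mem_sdiff, mem_setOf_eq]; tauto
  have hd0 : {ω : BondConfig (Fin n) | ¬ (openGraph (ω ∩ {e | o ∉ e})).Reachable p₁ p₀} ∩ S0 = S0 \ Rset := by
    ext ω; simp only [hRset, mem_inter_iff, mem_sdiff, mem_setOf_eq]; tauto
  rw [hd1, hd0]
  have h1 := measureReal_inter_add_sdiff (μ := prodBernoulli w) (s := S1)
    (MeasurableSet.of_discrete (s := Rset)) (measure_ne_top _ _)
  have h0' := measureReal_inter_add_sdiff (μ := prodBernoulli w) (s := S0)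
    (MeasurableSet.of_discrete (s := Rset)) (measure_ne_top _ _)
  rw [heq] at h1
  have hs' : (prodBernoulli w).real S1 ≤ (prodBernoulli w).real S0 := hs
  linarith

open CutObserver in
/-- **CIL for an observer with at most two relay neighbours, arbitrary graph elsewhere.**  If `o ∉ A` has positive-weight
edges only to the relays `p₀, p₁ ∈ A` (any weights; `p₀ = p₁` allowed; the rest of the weighted graph is arbitrary), then for
every level `j` some relay `a ∈ A` has `μ{1 ≤ N ≤ j} ≤ μ{|π(a)| ≤ j}` — the registered stub `stub_cumulativeIsolation`
(crux `NoHeavyLowerTail`, stmt-CriticalPhenomena-4575) on this class, for every `|A|`.  Witness: the port whose `H`-cluster is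
more often light. [folklore] -/
theorem cil_twoRelayNeighbours (w : Sym2 (Fin n) → unitInterval) (A : Finset (Fin n)) (o : Fin n) (j : ℕ)
    (p₀ p₁ : Fin n) (h0 : p₀ ∈ A) (h1 : p₁ ∈ A) (hoA : o ∉ A)
    (hobs : ∀ v, w s(o, v) ≠ 0 → v = p₀ ∨ v = p₁) :
    ∃ a ∈ A,
      (prodBernoulli w).real {ω : BondConfig (Fin n) |
          1 ≤ (A.filter fun x => ω ∈ openConn o x).card ∧ (A.filter fun x => ω ∈ openConn o x).card ≤ j} ≤
        (prodBernoulli w).real {ω : BondConfig (Fin n) | (A.filter fun x => ω ∈ openConn a x).card ≤ j} := by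
  by_cases hne : p₀ = p₁
  · -- one port: use p₁ := p₀ twice via the auxiliary form with a trivial comparison
    subst hne
    -- pick any other presentation: hobs with p₀ = p₁; apply aux with p₁ := p₀ is excluded (needs p₀ ≠ p₁),
    -- so argue directly: the minority event forces the edge o–p₀ open, whence π(p₀) = π(o).
    refine ⟨p₀, h0, ?_⟩
    rw [← measureReal_inter_support w]
    refine measureReal_mono (fun ω hω => ?_) (measure_ne_top _ _)
    obtain ⟨⟨h1', hj⟩, hG⟩ := hω
    obtain ⟨x, hx⟩ := Finset.card_pos.1 (by omega : 0 < (A.filter fun x => ω ∈ openConn o x).card)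
    rw [Finset.mem_filter] at hx
    have hxo : x ≠ o := fun h => hoA (h ▸ hx.1)
    obtain ⟨wk⟩ := (hx.2 : (openGraph ω).Reachable o x)
    cases wk with
    | nil => exact absurd rfl hxo
    | @cons _ v _ hadj _ =>
      rw [openGraph, SimpleGraph.fromEdgeSet_adj] at hadj
      have hv : v = p₀ := by rcases hobs v (hG _ hadj.1) with h | h <;> exact h
      subst hv
      have hreach : (openGraph ω).Reachable o v := by
        refine SimpleGraph.Adj.reachable ?_
        rw [openGraph, SimpleGraph.fromEdgeSet_adj]; exact hadj
      show (A.filter fun x => ω ∈ openConn v x).card ≤ j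
      have heq : (A.filter fun x => ω ∈ openConn v x) = (A.filter fun x => ω ∈ openConn o x) :=
        Finset.filter_congr fun x _ => ⟨fun h => hreach.trans h, fun h => hreach.symm.trans h⟩
      rw [heq]; exact hj
  · rcases le_total
        ((prodBernoulli w).real {ω : BondConfig (Fin n) |
          (A.filter fun x => (openGraph (ω ∩ {e | o ∉ e})).Reachable p₁ x).card ≤ j})
        ((prodBernoulli w).real {ω : BondConfig (Fin n) |
          (A.filter fun x => (openGraph (ω ∩ {e | o ∉ e})).Reachable p₀ x).card ≤ j}) with hle | hle
    · exact ⟨p₀, h0, cil_twoRelayNeighbours_aux w A o j p₀ p₁ hne h0 h1 hoA hobs hle⟩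
    · refine ⟨p₁, h1, cil_twoRelayNeighbours_aux w A o j p₁ p₀ (Ne.symm hne) h1 h0 hoA ?_ hle⟩
      intro v hv
      exact (hobs v hv).symm

end Summit.CriticalPhenomena.PercolationContinuityZ3.Theorems

end
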